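import Literature.NumberTheory.GaloisRepresentations.CorNaturality
import Literature.NumberTheory.GaloisRepresentations.ShapiroIsomorphism
import Literature.NumberTheory.GaloisRepresentations.ConjugationDescent
import Literature.NumberTheory.GaloisRepresentations.CyclicIndexEulerChar
import HarnessLib

/-!
# The corestriction is invariant under conjugation, degrees `1` and `2`: `cor ∘ (g · ) = cor`

Topic `NumberTheory/GaloisRepresentations`; namespace `Literature.NumberTheory.GaloisRepresentations`.
Definitions with bodies (the twist of the induced module as a `G`-morphism, two evaluation morphisms)
and theorems; no named fact, no instance, no `sorry`.

For a profinite group `G`, a closed NORMAL subgroup `S` of finite index, a discrete `G`-module `M`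
(`ρ`) and `g ∈ G`, the conjugation action `conjMap ρ.toTopRep S g q` of `g` on `H^q(S, M)`
(`ContinuousCorestriction.lean`; on cocycles `(g·φ)(x) = g φ(g⁻¹ x g)`) is killed by the Shapiro
corestriction `cor S ρ q : H^q(S, M) → H^q(G, M)` of `Corestriction.lean`:

  `cor (g · z) = cor z`     (`cor_conjMap_one`, `cor_conjMap_two`),

the all-degree analogue (here in degrees `1`, `2`, the degrees of the tree's inner-automorphism lemma
`map_eq_map_of_inner_one/_two`) of the degree-`1` transfer statement `cores_conjMap`
(`ContinuousCorestrictionConj.lean`). Degree `2` is what local invariants of open normal subgroups need: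
`inv_S := inv ∘ cor_{G/S}` on `H²(S, μₙ)` is conjugation invariant (Galois invariance (P2) of the
finite-level local Tate pairings along a `ℤ_p`-tower, K3 of the BSD cell).

Proof (Serre I §2.5 through the Shapiro isomorphism): `cor = H(N) ∘ sh⁻¹` (`cor_apply`, `sh_extMap`,
`shapiro_map_bijective`). The `G`-module automorphism `T_g` of `M_G^S(M)`, `(T_g F)(x) = g · F(g⁻¹ x)`
(the tree's `coindTwist`, here as the `G`-morphism `coindTwistHom`), satisfies `N ∘ T_g = N`
(`normCoind_coindTwistHom`: reindex `G/S` by right multiplication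
by `g`, `S` normal) and `g · (sh y) = sh (H(T_g) y)` (`conjMap_shMap_one/_two`: the compatible pairs
`(x ↦ g⁻¹ x g, F ↦ g F(1))` and `(S ↪ G, F ↦ (T_g F)(1) = g F(g⁻¹))` are inner-conjugate, tree
`map_eq_map_of_inner_one/_two`).

## References
* J.-P. Serre, *Galois Cohomology* (1997), I §2.5 (corestriction via induced modules). [SerreGaloisCohomology1997]
* J.-P. Serre, *Local Fields* (1979), VII §5 Prop. 3 (inner automorphisms act trivially). [SerreLocalFields1979]
* J. Neukirch, A. Schmidt, K. Wingberg, *Cohomology of Number Fields* (2008), I §5 (cor and conjugation,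
  Prop. 1.5.4). [NeukirchSchmidtWingberg2008]
-/

noncomputable section

open CategoryTheory Function

universe u

namespace Literature.NumberTheory.GaloisRepresentations

open _root_.TopRep _root_.ContRepresentation _root_.ContinuousCohomology
open Literature.NumberTheory.EllipticCurves (subgroupConj subgroupConj_apply_coe)

section ConjCor

variable {G : Type u} [Group G] [TopologicalSpace G] [IsTopologicalGroup G] [CompactSpace G]
  [T2Space G] [TotallyDisconnectedSpace G]
variable (S : Subgroup G) [hS : IsClosed (S : Set G)] [hN : S.Normal]
variable {M : Type u} [AddCommGroup M] [TopologicalSpace M] [DiscreteTopology M]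
variable (ρ : ContinuousRep G ℤ M) (g : G)

attribute [local instance] compactSpace_of_isClosed_subgroup discreteTopology_coind

/-! ### §1 The twist `T_g` of the induced module, as a morphism of `G`-modules -/

/-- **The twist `T_g : M_G^S(M) → M_G^S(M)`, `(T_g F)(x) = g · F(g⁻¹ x)`** (`S` normal) — the tree's
`ℤ`-linear `coindTwist S ρ g` (`CyclicIndexEulerChar.lean`), which commutes with the `G`-action
(`coindTwist_comm`), packaged as a morphism of discrete `G`-modules. [cite: SerreGaloisCohomology1997, I §2.5] -/
def coindTwistHom : (coindRep (ρ.restrict (subgroupIncl S))).toTopRep ⟶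
    (coindRep (ρ.restrict (subgroupIncl S))).toTopRep :=
  TopRep.ofHom
    { toLinearMap := coindTwist S ρ g
      cont := continuous_of_discreteTopology
      isIntertwining' := fun h => by
        ext F x
        exact congrArg (fun F' : coindModule (ρ.restrict (subgroupIncl S)) => (F' : C(G, M)) x)
          (coindTwist_comm S ρ g h F) }

omit [T2Space G] [TotallyDisconnectedSpace G] hS in
/-- `T_g` on elements: `(T_g F)(x) = g · F(g⁻¹ x)`. [cite: SerreGaloisCohomology1997, I §2.5] -/
@[simp] theorem coindTwistHom_coe_apply (F : coindModule (ρ.restrict (subgroupIncl S))) (x : G) :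
    (((coindTwistHom S ρ g).hom F : coindModule (ρ.restrict (subgroupIncl S))) : C(G, M)) x =
      ρ g ((F : C(G, M)) (g⁻¹ * x)) := rfl

variable [Fintype (G ⧸ S)]

omit [T2Space G] [TotallyDisconnectedSpace G] hS in
/-- **`N ∘ T_g = N`**: `Σ_c c̃ · g F(g⁻¹ c̃⁻¹) = Σ_c (c̃ g) · F((c̃ g)⁻¹)`, and `c ↦ c̃ g S` permutes
`G/S` (right multiplication by `g` in the group `G/S`, `S` normal). [cite: SerreGaloisCohomology1997, I §2.5] -/
theorem normCoind_coindTwistHom (F : coindModule (ρ.restrict (subgroupIncl S))) :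
    (normCoind (S := S) ρ).hom ((coindTwistHom S ρ g).hom F) = (normCoind (S := S) ρ).hom F := by
  classical
  rw [normCoind_hom_apply, normCoind_hom_apply]
  have h1 : ∀ c : G ⧸ S, ρ c.out ((((coindTwistHom S ρ g).hom F :
      coindModule (ρ.restrict (subgroupIncl S))) : C(G, M)) c.out⁻¹) = normTerm ρ F (c.out * g) := by
    intro c
    rw [coindTwistHom_coe_apply, ← Module.End.mul_apply, ← map_mul, ← mul_inv_rev]
    rfl
  simp_rw [h1]
  change _ = ∑ c : G ⧸ S, normTerm ρ F c.out
  have hbij : Function.Bijective fun c : G ⧸ S => ((c.out * g : G) : G ⧸ S) := by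
    have he : (fun c : G ⧸ S => ((c.out * g : G) : G ⧸ S)) = fun c => c * (g : G ⧸ S) := by
      funext c
      rw [QuotientGroup.mk_mul, QuotientGroup.out_eq']
    rw [he]
    exact Group.mulRight_bijective (g : G ⧸ S)
  exact Fintype.sum_bijective _ hbij _ _ fun c => normTerm_eq_of_coe_eq ρ F (QuotientGroup.out_eq' _).symm

/-! ### §2 `g · sh(y) = sh (H(T_g) y)` -/

/-- The evaluation `F ↦ g · F(1)` along `x ↦ g⁻¹ x g : S → G` (module half of `(g·) ∘ sh`).
[cite: SerreGaloisCohomology1997, I §2.5] -/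
def evalOneConj : TopRep.res (((subgroupIncl S).comp (subgroupConj S g) : S →ₜ* G) : S →* G)
      (coindRep (ρ.restrict (subgroupIncl S))).toTopRep ⟶ (ρ.restrict (subgroupIncl S)).toTopRep :=
  TopRep.ofHom
    { toLinearMap := (ρ g).comp
        (coindEvalOne (ρ.restrict (subgroupIncl S))).hom.toLinearMap
      cont := continuous_of_discreteTopology
      isIntertwining' := fun s => by
        ext F
        change ρ g ((((coindRep (ρ.restrict (subgroupIncl S))) (g⁻¹ * (s : G) * g) F :
            coindModule (ρ.restrict (subgroupIncl S))) : C(G, M)) 1) =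
          ρ (subgroupIncl S s) (ρ g (((F : coindModule (ρ.restrict (subgroupIncl S))) : C(G, M)) 1))
        rw [coindRep_apply_apply, one_mul]
        have e : g⁻¹ * (s : G) * g = g⁻¹ * ((s : G) * g) := mul_assoc _ _ _
        rw [e]
        have key : ρ g (((F : coindModule (ρ.restrict (subgroupIncl S))) : C(G, M)) (g⁻¹ * ((s : G) * g))) =
            ρ (s : G) (ρ g (((F : coindModule (ρ.restrict (subgroupIncl S))) : C(G, M)) (g⁻¹ * g))) :=
          (mem_coind_iff (ρ.restrict (subgroupIncl S)) _).1 (coindTwist S ρ g F).2 s g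
        rw [inv_mul_cancel] at key
        rw [key]
        rfl }

/-- The evaluation `F ↦ (T_g F)(1) = g · F(g⁻¹)` along `S ↪ G` (module half of `sh ∘ H(T_g)`).
[cite: SerreGaloisCohomology1997, I §2.5] -/
def evalTwistOne : TopRep.res (subgroupIncl S : S →* G) (coindRep (ρ.restrict (subgroupIncl S))).toTopRep ⟶
    (ρ.restrict (subgroupIncl S)).toTopRep :=
  TopRep.ofHom
    { toLinearMap := (coindEvalOne (ρ.restrict (subgroupIncl S))).hom.toLinearMap.comp
        (coindTwistHom S ρ g).hom.toLinearMap
      cont := continuous_of_discreteTopology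
      isIntertwining' := fun s => by
        ext F
        change (coindEvalOne (ρ.restrict (subgroupIncl S))).hom
            ((coindTwistHom S ρ g).hom ((coindRep (ρ.restrict (subgroupIncl S))) (subgroupIncl S s) F)) =
          (ρ.restrict (subgroupIncl S)) s ((coindEvalOne (ρ.restrict (subgroupIncl S))).hom
            ((coindTwistHom S ρ g).hom F))
        rw [ContinuousRep.hom_comm_apply (coindTwistHom S ρ g)]
        exact TopRep.hom_comm_apply (coindEvalOne (ρ.restrict (subgroupIncl S))) s _ }

omit [T2Space G] [TotallyDisconnectedSpace G] hS [Fintype (G ⧸ S)] in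
/-- The two evaluation morphisms are inner-conjugate by `g`: `g F(1) = (T_g (g • F))(1)`.
[cite: SerreGaloisCohomology1997, I §2.5] -/
theorem evalOneConj_eq (F : coindModule (ρ.restrict (subgroupIncl S))) :
    (evalOneConj S ρ g).hom F =
      (evalTwistOne S ρ g).hom ((coindRep (ρ.restrict (subgroupIncl S))).toTopRep.ρ g F) := by
  change ρ g ((F : C(G, M)) 1) =
    ρ g (((((coindRep (ρ.restrict (subgroupIncl S))) g F : coindModule (ρ.restrict (subgroupIncl S)))) :
      C(G, M)) (g⁻¹ * 1))
  rw [coindRep_apply_apply, mul_one, inv_mul_cancel]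

omit [T2Space G] [TotallyDisconnectedSpace G] hS [Fintype (G ⧸ S)] in
/-- **`g · (sh y) = sh (H(T_g) y)` on `H¹`.** [cite: SerreGaloisCohomology1997, I §2.5] -/
theorem conjMap_shMap_one (y : continuousCohomology 1 (coindRep (ρ.restrict (subgroupIncl S))).toTopRep) :
    conjMap ρ.toTopRep S g 1 (shMap S ρ 1 y) = shMap S ρ 1 (cohomologyMap (coindTwistHom S ρ g) 1 y) := by
  have h1 : conjMap ρ.toTopRep S g 1 (shMap S ρ 1 y) =
      ContinuousCohomology.map ((subgroupIncl S).comp (subgroupConj S g)) (evalOneConj S ρ g) 1 y :=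
    (map_comp_apply_of (subgroupIncl S) (subgroupConj S g) ((subgroupIncl S).comp (subgroupConj S g))
      (fun _ => rfl) (coindEvalOne (ρ.restrict (subgroupIncl S))) (conjRepHom ρ.toTopRep S g)
      (evalOneConj S ρ g) (fun _ => rfl) 1 y).symm
  have h2 : shMap S ρ 1 (cohomologyMap (coindTwistHom S ρ g) 1 y) =
      ContinuousCohomology.map (subgroupIncl S) (evalTwistOne S ρ g) 1 y :=
    (map_comp_apply_of (ContinuousMonoidHom.id G) (subgroupIncl S) (subgroupIncl S) (fun _ => rfl)
      (resIdHom (coindTwistHom S ρ g)) (coindEvalOne (ρ.restrict (subgroupIncl S)))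
      (evalTwistOne S ρ g) (fun _ => rfl) 1 y).symm
  rw [h1, h2]
  exact map_eq_map_of_inner_one g (subgroupIncl S) ((subgroupIncl S).comp (subgroupConj S g))
    (fun _ => rfl) (evalOneConj S ρ g) (evalTwistOne S ρ g) (evalOneConj_eq S ρ g) y

omit [TotallyDisconnectedSpace G] [Fintype (G ⧸ S)] in
/-- **`g · (sh y) = sh (H(T_g) y)` on `H²`.** [cite: SerreGaloisCohomology1997, I §2.5] -/
theorem conjMap_shMap_two (y : continuousCohomology 2 (coindRep (ρ.restrict (subgroupIncl S))).toTopRep) :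
    conjMap ρ.toTopRep S g 2 (shMap S ρ 2 y) = shMap S ρ 2 (cohomologyMap (coindTwistHom S ρ g) 2 y) := by
  haveI : LocallyCompactSpace S := inferInstance
  have h1 : conjMap ρ.toTopRep S g 2 (shMap S ρ 2 y) =
      ContinuousCohomology.map ((subgroupIncl S).comp (subgroupConj S g)) (evalOneConj S ρ g) 2 y :=
    (map_comp_apply_of (subgroupIncl S) (subgroupConj S g) ((subgroupIncl S).comp (subgroupConj S g))
      (fun _ => rfl) (coindEvalOne (ρ.restrict (subgroupIncl S))) (conjRepHom ρ.toTopRep S g)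
      (evalOneConj S ρ g) (fun _ => rfl) 2 y).symm
  have h2 : shMap S ρ 2 (cohomologyMap (coindTwistHom S ρ g) 2 y) =
      ContinuousCohomology.map (subgroupIncl S) (evalTwistOne S ρ g) 2 y :=
    (map_comp_apply_of (ContinuousMonoidHom.id G) (subgroupIncl S) (subgroupIncl S) (fun _ => rfl)
      (resIdHom (coindTwistHom S ρ g)) (coindEvalOne (ρ.restrict (subgroupIncl S)))
      (evalTwistOne S ρ g) (fun _ => rfl) 2 y).symm
  rw [h1, h2]
  exact map_eq_map_of_inner_two g (subgroupIncl S) ((subgroupIncl S).comp (subgroupConj S g))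
    (fun _ => rfl) (evalOneConj S ρ g) (evalTwistOne S ρ g) (evalOneConj_eq S ρ g) y

/-! ### §3 `cor ∘ (g ·) = cor` -/

omit [T2Space G] [TotallyDisconnectedSpace G] hS in
/-- `T_g ≫ N = N` as morphisms. [cite: SerreGaloisCohomology1997, I §2.5] -/
theorem coindTwistHom_comp_normCoind : coindTwistHom S ρ g ≫ normCoind (S := S) ρ = normCoind (S := S) ρ :=
  TopRep.hom_ext (DFunLike.ext _ _ fun F => normCoind_coindTwistHom S ρ g F)

/-- **`cor (g · z) = cor z` on `H¹(S, M)`** (`S` closed normal of finite index, `g ∈ G`).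
[cite: NeukirchSchmidtWingberg2008, I §5 Prop. 1.5.4] [cite: SerreGaloisCohomology1997, I §2.5] -/
theorem cor_conjMap_one (z : continuousCohomology 1 (ρ.restrict (subgroupIncl S)).toTopRep) :
    cor S ρ 1 (conjMap ρ.toTopRep S g 1 z) = cor S ρ 1 z := by
  obtain ⟨y, hy⟩ := shapiro_map_surjective (ρ.restrict (subgroupIncl S)) 1 z
  have hy' : shMap S ρ 1 y = z := hy
  have h1 : extMap S ρ 1 (conjMap ρ.toTopRep S g 1 z) = cohomologyMap (coindTwistHom S ρ g) 1 y := by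
    apply shapiro_map_injective (ρ.restrict (subgroupIncl S)) 1
    change shMap S ρ 1 (extMap S ρ 1 (conjMap ρ.toTopRep S g 1 z)) =
      shMap S ρ 1 (cohomologyMap (coindTwistHom S ρ g) 1 y)
    rw [sh_extMap, ← conjMap_shMap_one, hy']
  have h2 : extMap S ρ 1 z = y := by
    apply shapiro_map_injective (ρ.restrict (subgroupIncl S)) 1
    change shMap S ρ 1 (extMap S ρ 1 z) = shMap S ρ 1 y
    rw [sh_extMap, hy']
  rw [cor_apply, cor_apply, h1, h2, ← cohomologyMap_comp_apply, coindTwistHom_comp_normCoind]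

/-- **`cor (g · z) = cor z` on `H²(S, M)`** (`S` closed normal of finite index, `g ∈ G`): the
degree-`2` conjugation invariance of the corestriction.
[cite: NeukirchSchmidtWingberg2008, I §5 Prop. 1.5.4] [cite: SerreGaloisCohomology1997, I §2.5] -/
theorem cor_conjMap_two (z : continuousCohomology 2 (ρ.restrict (subgroupIncl S)).toTopRep) :
    cor S ρ 2 (conjMap ρ.toTopRep S g 2 z) = cor S ρ 2 z := by
  obtain ⟨y, hy⟩ := shapiro_map_surjective (ρ.restrict (subgroupIncl S)) 2 z
  have hy' : shMap S ρ 2 y = z := hy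
  have h1 : extMap S ρ 2 (conjMap ρ.toTopRep S g 2 z) = cohomologyMap (coindTwistHom S ρ g) 2 y := by
    apply shapiro_map_injective (ρ.restrict (subgroupIncl S)) 2
    change shMap S ρ 2 (extMap S ρ 2 (conjMap ρ.toTopRep S g 2 z)) =
      shMap S ρ 2 (cohomologyMap (coindTwistHom S ρ g) 2 y)
    rw [sh_extMap, ← conjMap_shMap_two, hy']
  have h2 : extMap S ρ 2 z = y := by
    apply shapiro_map_injective (ρ.restrict (subgroupIncl S)) 2
    change shMap S ρ 2 (extMap S ρ 2 z) = shMap S ρ 2 y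
    rw [sh_extMap, hy']
  rw [cor_apply, cor_apply, h1, h2, ← cohomologyMap_comp_apply, coindTwistHom_comp_normCoind]

end ConjCor

end Literature.NumberTheory.GaloisRepresentations
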